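/-
Copyright: the b2b-balaban T⁴-continuum CRUX team, row NE7b OWNER lineage `t4-ne7b-p1` (gen 117). Project licence.
-/
import Summits.QuantumFields.BalabanUV.T4Continuum.Spine.NE7b.SupTorusEffectiveActionHessianFloor

/-!
# THE NEXT-SCALE ACTION IS STRICTLY CONVEX AT THE SMALL-FIELD BACKGROUND — THE INSTANCE: for SBTL's localised small-field
# background `σt` of the perturbed Gaussian skeleton on the torus `(ℤ∕(n+1)s)^d` (`d ≥ 3`, SBTL's binders VERBATIM + a primitive `v`
# of `u`), on the open torus ball the Hessian `H2` of the effective action `wt ↦ S(σt wt)` (HESS: `= (n+1)^d ×` (65)'s next-scale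
# operator conjugated to the torus) satisfies `(min(2,a) − λ)·Σ_x (Rf(Dσ(Ec k)) x)² ≤ H2 k k` and, when `λ ≤ min(2,a)`,
# `(min(2,a) − λ)·(n+1)^d·Σ_y k y² ≤ H2 k k` — modulus free of the mesh `n`, the period `s` and the dimension
# (row NE7b, node U5c; (90) `hessian_effectiveAction_torus_floor_of_letters` on SBTL's package, HESS §3's road; [folklore])

Cell `pub-balaban`, sub-cell `t4`, spine estimate NE7b (`T4WeightBudget.RelWeightBound`; the cell's OWN estimate — NOT PRINTED in
[Bałaban 1983–89], NOT PROVED).  Crux-route work under `Spine/NE7b/` by the row OWNER (`t4-ne7b-p1` gen 117) under FREEZE (0)'s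
crux-prover clause; NOTHING of Bałaban's is named as a Lean object, valued or asserted; no `T4Continuum/Support` leaf typed; no
`def`, no notation; zero `sorry`.  Imports (BY NAME): the OWNER's (90) `…SupTorusEffectiveActionHessianFloor`
(`hessian_effectiveAction_torus_floor_of_letters`; through it HESS ∕ INST ∕ SBTL `exists_background_torus_localised`).

WHY (located).  HESS §3 opened SBTL's package once to feed its letters theorem; the floor needs the SAME letters ((63)'s linearised
fibre equation for the response at `Ec wt`, the section property, the closed-ball identification) plus SBTL's own `|u′| ≤ λ`, which is
already a binder.  So the instance is HESS §3's road with (90)'s END in place of HESS §2's: the statement below is HESS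
`exists_effectiveAction_hessian_torus` VERBATIM with two conjuncts added under the open-ball clause.  In the window `λ < min(2,a)` the
second says: the effective action of the next scale is strictly convex at the background with modulus `(min(2,a) − λ)(n+1)^d` in the
coarse `ℓ²` pairing — the stability letter an RG iteration of the sup road would consume, uniform in the torus.

WHAT IS PROVED ([folklore]): **`exists_effectiveAction_hessian_torus_floor`** (`d ≥ 3`; SBTL's binders VERBATIM + a primitive `v` of
`u`; every `s ≥ 1`): SBTL's `Q′ ∕ A ∕ N′ ∕ σ`, carriers and `σt` re-exported with their actions, `σt 0 = 0`, SBTL's closed-ball FIVE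
(they pin `σt`), AND on the open torus ball `‖wt‖ < (N⁻¹ − c)r`: `σ` differentiable at `Ec wt` and
`∃ H2, HasFDerivAt (fderiv (S∘σt)) H2 wt ∧ (H2 k k′ = (n+1)^d·Σ_y (Rc(Q′(A(Dσ(Ec k)) + N′(σ(Ec wt))(Dσ(Ec k))))) y·k′ y) ∧
(∀ k, (min(2,a) − λ)·Σ_x (Rf(Dσ(Ec k)) x)² ≤ H2 k k) ∧ (λ ≤ min(2,a) → ∀ k, (min(2,a) − λ)·(n+1)^d·Σ_y k y² ≤ H2 k k)`,
`Dσ := fderiv ℝ σ (Ec wt)`.  §2 toy.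

HONEST (what this is NOT).  HESS §3's destructuring + (90) by name; constants `(N, c, λ)` are SBTL's ∕ (63)'s (existential, useless by
value at small sides) and the modulus `min(2,a) − λ` is OURS, not sharp, positive only when `λ < min(2,a)` (NOT implied by SBTL's
`2λ ≤ c < N⁻¹` unless `N⁻¹ ≤ 2·min(2,a)` — a side condition, displayed as the hypothesis of the last conjunct, not discharged); no
minimality (CRIT: criticality only), no convexity away from the background, nothing about the measure; cubic periods; scalar
skeleton, not the covariant operators ((A3), NC-NE7b-α UNRULED); nothing of Bałaban's.  BY-NAME EFFECT ON THE WALL: NONE.  NE7b NOT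
PRINTED ∕ NOT PROVED; spine PROVED 0∕9; rung (B)+1 on a FINITE torus — NOT infinite volume, NOT the mass gap, NOT Clay.  HONEST
DEPENDENCY: continuum YM on T⁴ ⇐ BetaPertH ∧ nine spine estimates (0∕9 proved); BetaPertH ⇐ (D1) ∧ (D4) ∧ CAP+tail; G-an2-4 gates
asym, D1 and NE2∕3∕4.
-/

set_option autoImplicit false

noncomputable section

namespace Summit.QuantumFields.BalabanUV.T4Continuum.NE7b.SupTorusEffectiveActionHessianFloorInstance

open Set Metric Function
open scoped ENNReal NNReal Topology
open Literature.MathematicalPhysics.QuantumFieldTheory.Balaban1983to89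
open B4Sect5Proof (latticeConst)
open B6QGQLower276 (X blk B side AX)
open B6QGQDecay237 (deltaU)
open B5Hk103ScalarZd (nbhd deltaH)
open Summit.QuantumFields.BalabanUV.Beta.D1BFx.BlockColumnSupNorm (cHs)
open Summit.QuantumFields.BalabanUV.Beta.D1BFx.PointColumnSplit (cKL cG0 cSplit)
open Summit.QuantumFields.BalabanUV.Beta.D1BFx.PointColumnDecay (cFar)
open Beta (Site siteOf windowMap)
open SupBackgroundTorusLocalised (exists_background_torus_localised)
open SupTorusEffectiveActionHessianFloor (hessian_effectiveAction_torus_floor_of_letters)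

variable {d : ℕ}

/-! ## §1. The instance on SBTL's localised small-field background -/

/-- **THE HESSIAN OF THE TORUS EFFECTIVE ACTION AT THE SMALL-FIELD BACKGROUND AND ITS FLOOR** (`d ≥ 3`; SBTL's binders VERBATIM + a
primitive `v` of `u`; every coarse period `s ≥ 1`): HESS `exists_effectiveAction_hessian_torus`'s package VERBATIM (operators, carrier
maps and `σt` with their actions, `σt 0 = 0`, SBTL's closed-ball FIVE pinning `σt`, and on the open torus ball `‖wt‖ < (N⁻¹ − c)r`:
`σ` differentiable at `Ec wt`, `∃ H2, HasFDerivAt (fderiv (S∘σt)) H2 wt` with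
`H2 k k′ = (n+1)^d·Σ_y (Rc(Q′(A(Dσ(Ec k)) + N′(σ(Ec wt))(Dσ(Ec k))))) y·k′ y`, `Dσ := fderiv ℝ σ (Ec wt)`) AND THE FLOORS
`(min(2,a) − λ)·Σ_x (Rf(Dσ(Ec k)) x)² ≤ H2 k k` (every `k`, no sign condition) and
`λ ≤ min(2,a) → (min(2,a) − λ)·(n+1)^d·Σ_y k y² ≤ H2 k k` — strict convexity of the next-scale action at the background, modulus mesh-
and volume-free. [folklore] -/
theorem exists_effectiveAction_hessian_torus_floor (hd : 3 ≤ d) (n : ℕ) {a : ℝ} (ha : 0 < a)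
    {v u u' : ℝ → ℝ} (hv : ∀ t, HasDerivAt v (u t) t) (hu : ∀ t, HasDerivAt u (u' t) t) (hu0 : u 0 = 0) {lam c N : ℝ≥0}
    (hlam : ∀ t, |u' t| ≤ lam) {L : ℝ} (hL0 : 0 ≤ L) (hL : ∀ s t, |u' s - u' t| ≤ L * |s - t|)
    (hN : cHs d a * latticeConst d (deltaH d a)
        + ((cG0 d * cKL d (d - 2) + cSplit d a) * Real.exp (2 * deltaU d a)
            + cFar d a * Real.exp (4 * deltaU d a) / deltaU d a ^ 2) * latticeConst d (deltaU d a / 4)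
          * (1 + cHs d a * latticeConst d (deltaH d a)) ≤ (N : ℝ))
    (hc : 2 * lam ≤ c) (hcN : c < N⁻¹) {r : ℝ} (hr : 0 ≤ r) (s : ℕ) [NeZero s] :
    ∃ (Dop Aop : lp (fun _ : X d => ℝ) ∞ →L[ℝ] lp (fun _ : X d => ℝ) ∞)
      (N' : lp (fun _ : X d => ℝ) ∞ → (lp (fun _ : X d => ℝ) ∞ →L[ℝ] lp (fun _ : X d => ℝ) ∞))
      (σ : lp (fun _ : X d => ℝ) ∞ → lp (fun _ : X d => ℝ) ∞)
      (Ef : (Site d ((n + 1) * s) → ℝ) →L[ℝ] lp (fun _ : X d => ℝ) ∞)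
      (Rf : lp (fun _ : X d => ℝ) ∞ →L[ℝ] (Site d ((n + 1) * s) → ℝ))
      (Ec : (Site d s → ℝ) →L[ℝ] lp (fun _ : X d => ℝ) ∞)
      (Rc : lp (fun _ : X d => ℝ) ∞ →L[ℝ] (Site d s → ℝ))
      (σt : (Site d s → ℝ) → (Site d ((n + 1) * s) → ℝ)),
      (∀ (f : lp (fun _ : X d => ℝ) ∞) (y : X d), Dop f y = (((n : ℝ) + 1) ^ d)⁻¹ * ∑ p ∈ B n y, f p) ∧
      (∀ (f : lp (fun _ : X d => ℝ) ∞) (p : X d), Aop f p = ∑ r ∈ nbhd n p, AX n a p r * f r) ∧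
      (∀ (φ h : lp (fun _ : X d => ℝ) ∞) (p : X d), N' φ h p = u' (φ p) * h p) ∧
      (∀ (g : Site d ((n + 1) * s) → ℝ) (q : X d), Ef g q = g (siteOf d ((n + 1) * s) q)) ∧
      (∀ (h : lp (fun _ : X d => ℝ) ∞) (x : Site d ((n + 1) * s)), Rf h x = h (windowMap d ((n + 1) * s) x)) ∧
      (∀ (g : Site d s → ℝ) (q : X d), Ec g q = g (siteOf d s q)) ∧
      (∀ (h : lp (fun _ : X d => ℝ) ∞) (x : Site d s), Rc h x = h (windowMap d s x)) ∧
      (∀ wt, σt wt = Rf (σ (Ec wt))) ∧ σt 0 = 0 ∧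
      -- SBTL's closed-ball identification of the torus background (the closed-ball FIVE, verbatim): it PINS `σt`
      (∀ wt ∈ closedBall (0 : Site d s → ℝ) (((N : ℝ)⁻¹ - c) * r),
        σt wt ∈ closedBall 0 r ∧ Ef (σt wt) = σ (Ec wt) ∧ Dop (Ef (σt wt)) = Ec wt ∧ Rc (Dop (Ef (σt wt))) = wt ∧
          ∀ p : X d, Aop (Ef (σt wt)) p + u (Ef (σt wt) p)
            = (((n : ℝ) + 1) ^ d)⁻¹ * ∑ p' ∈ B n (blk n p), (Aop (Ef (σt wt)) p' + u (Ef (σt wt) p'))) ∧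
      -- THE HESSIAN OF THE TORUS EFFECTIVE ACTION on the open torus ball, AND ITS FLOORS
      ∀ wt ∈ ball (0 : Site d s → ℝ) (((N : ℝ)⁻¹ - c) * r),
        DifferentiableAt ℝ σ (Ec wt) ∧
        ∃ H2 : (Site d s → ℝ) →L[ℝ] (Site d s → ℝ) →L[ℝ] ℝ,
          HasFDerivAt (fderiv ℝ ((fun φ : Site d ((n + 1) * s) → ℝ =>
              (1 / 2 : ℝ) * ∑ x, φ x * ((Rf.comp Aop).comp Ef) φ x + ∑ x, v (φ x)) ∘ σt)) H2 wt ∧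
          (∀ k k' : Site d s → ℝ, H2 k k'
            = ((n : ℝ) + 1) ^ d * ∑ y : Site d s,
                Rc (Dop (Aop (fderiv ℝ σ (Ec wt) (Ec k)) + N' (σ (Ec wt)) (fderiv ℝ σ (Ec wt) (Ec k)))) y * k' y) ∧
          (∀ k : Site d s → ℝ, (min 2 a - (lam : ℝ)) * ∑ x, Rf (fderiv ℝ σ (Ec wt) (Ec k)) x ^ 2 ≤ H2 k k) ∧
          ((lam : ℝ) ≤ min 2 a →
            ∀ k : Site d s → ℝ, (min 2 a - (lam : ℝ)) * (((n : ℝ) + 1) ^ d * ∑ y, k y ^ 2) ≤ H2 k k) := by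
  obtain ⟨Dop, Aop, Pop, N', σ, Cf, Ef, Rf, Ec, Rc, σt, hD, hA, hP, hN'app, -, -, -, hint, -, hEf, hRf, hEc, hRc, -, -, hEcn, -,
    hσt, hσt0, hball, -, -, htorus⟩ := exists_background_torus_localised hd n ha hu hu0 hlam hL0 hL hN hc hcN hr s
  refine ⟨Dop, Aop, N', σ, Ef, Rf, Ec, Rc, σt, hD, hA, hN'app, hEf, hRf, hEc, hRc, hσt, hσt0, hball, fun wt hwt => ?_⟩
  have hlam' : ∀ t, |u' t| ≤ (lam : ℝ) := hlam
  -- the response family `w′ ↦ fderiv ℝ σ (Ec w′)` on the open torus ball, with SBTL's letters transported along `HasFDerivAt.fderiv`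
  have hDer : ∀ w' ∈ ball (0 : Site d s → ℝ) (((N : ℝ)⁻¹ - c) * r), HasFDerivAt σ (fderiv ℝ σ (Ec w')) (Ec w') :=
    fun w' hw' => by
      obtain ⟨⟨D, hDσ, -, -, -, -⟩, -, -, -⟩ := htorus w' hw'
      exact hDσ.differentiableAt.hasFDerivAt
  have hsec : ∀ w' ∈ ball (0 : Site d s → ℝ) (((N : ℝ)⁻¹ - c) * r), ∀ k : Site d s → ℝ,
      Rc (Dop (Ef (((Rf.comp (fderiv ℝ σ (Ec w'))).comp Ec) k))) = k := fun w' hw' k => by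
    obtain ⟨⟨D, hDσ, -, -, -, hsecD⟩, -, -, -⟩ := htorus w' hw'
    rw [hDσ.fderiv]
    exact hsecD k
  have heq : ∀ w' ∈ ball (0 : Site d s → ℝ) (((N : ℝ)⁻¹ - c) * r), ∀ p : X d, Aop (Ef (σt w')) p + u (Ef (σt w') p)
      = (((n : ℝ) + 1) ^ d)⁻¹ * ∑ p' ∈ B n (blk n p), (Aop (Ef (σt w')) p' + u (Ef (σt w') p')) :=
    fun w' hw' => (hball w' (ball_subset_closedBall hw')).2.2.2.2
  have hEfσ : Ef (σt wt) = σ (Ec wt) := (hball wt (ball_subset_closedBall hwt)).2.1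
  obtain ⟨⟨D, hDσ, -, hEfD, -, -⟩, -, -, -⟩ := htorus wt hwt
  have hEfD' : ∀ vt, Ef (((Rf.comp (fderiv ℝ σ (Ec wt))).comp Ec) vt) = fderiv ℝ σ (Ec wt) (Ec vt) := fun vt => by
    rw [hDσ.fderiv]
    exact hEfD vt
  -- (63)'s interior package at `Ec wt`: the linearised fibre equation for ITS response, which is `fderiv ℝ σ (Ec wt)`
  have hballEc : Ec wt ∈ ball (0 : lp (fun _ : X d => ℝ) ∞) (((N : ℝ)⁻¹ - c) * r) := by
    rw [mem_ball_zero_iff] at hwt ⊢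
    rwa [hEcn]
  obtain ⟨⟨D', hD'σ, -, -, hfibD', -⟩, -⟩ := hint (Ec wt) hballEc
  have hfib : ∀ k : Site d s → ℝ,
      Pop (Aop (fderiv ℝ σ (Ec wt) (Ec k)) + N' (σ (Ec wt)) (fderiv ℝ σ (Ec wt) (Ec k))) = 0 := fun k => by
    rw [hD'σ.fderiv]
    exact hfibD' (Ec k)
  obtain ⟨H2, hH2, hH2app, hfloorR, hfloorC⟩ := hessian_effectiveAction_torus_floor_of_letters n a s hD hA hP hN'app hlam' hEf
    hRf hRc hv hu hσt hwt hDer hsec heq hEfσ hEfD' hfib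
  refine ⟨hDσ.differentiableAt, H2, hH2, fun k k' => ?_, fun k => ?_, fun hγ k => hfloorC hγ k⟩
  · rw [hH2app k k']
    simp only [ContinuousLinearMap.comp_apply, add_apply]
  · have h := hfloorR k
    simpa only [ContinuousLinearMap.comp_apply] using h

/-! ## §2. Toy -/

/-- Toy: the two floor conjuncts are vacuously consistent at `k = 0` (both sides vanish) — a shape check of the coarse floor at the zero
coarse field on the one-point coarse torus. -/
example (n : ℕ) (a lam : ℝ) (H2 : (Site d 1 → ℝ) →L[ℝ] (Site d 1 → ℝ) →L[ℝ] ℝ) :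
    (min 2 a - lam) * (((n : ℝ) + 1) ^ d * ∑ y, (0 : Site d 1 → ℝ) y ^ 2) ≤ H2 0 0 := by
  simp

end Summit.QuantumFields.BalabanUV.T4Continuum.NE7b.SupTorusEffectiveActionHessianFloorInstance

end
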